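import Summits.QuantumFields.BalabanUV.T4Continuum.Support.NE7LawLevelOldLayers

/-!
# NE7, ROAD P4 (law-level): NODE Q.old's producer — the L¹ FORM OF THE TAYLOR REMAINDER
# (`OldLayerDatumL1`, `OldLayerBudgetL1` ⇒ `PureAverageL1Rate`)

(Cell `pub-balaban`, sub-cell `t4`, binder row NE7 = node U5, co-owner #4 `b2b-balaban-t4-ne7-p4`, gen 2; skeleton
`HOME/t4/skeletons/NE7-t4-ne7-p4.md` §2 NODE Q (v1.7).  Imports the road's `NE7LawLevelOldLayers` (p209362: the exact
layer identity of the second moment along the chain's reverse filtration, `OldLayerDatum`, `integral_abs_sub_le_total`,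
`pureAverageL1Rate_of_oldLayerBudget`).)

HONEST FRAMING (T4-DAG PAGE 1).  Rung (B)+1 on ONE FIXED finite four-torus, CONDITIONAL on `BetaPertH` and the nine
spine estimates (0/9 proved); NOT infinite volume, NOT a mass gap, NOT the Clay problem.  NE7 is NOT PRINTED and NOT
proved here; every `def … : Prop` / `structure` below is a HYPOTHESIS SHAPE over plain probabilistic data, every
theorem is [folklore] measure theory ∕ bookkeeping, sorry-free; no statement of the audited series is asserted or used;
NOT summit progress.

WHAT THIS FILE DOES.  In the dictionary of `NE7LawLevelOldLayers` the second-order Taylor term of `W ∘ avgⁿ` in the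
resampling kicks is `½|W″|·|δu|²` with `δu` the random TOTAL displacement of the unit links — small in MEAN (it is
controlled by the very second moments booked there), NOT pointwise (if every old component kicked coherently, `|δu|`
would be `O(1)`).  The honest remainder hypothesis is therefore an L¹ budget: `OldLayerDatumL1` is `OldLayerDatum` with
the pointwise field `taylor` replaced by `taylorL1 : ∫ |F − Φp − Σ_n S n| dP ≤ rem`.  On a probability space the
pointwise datum is a special case (`OldLayerDatum.toL1`); the total bound (`integral_abs_sub_le_totalL1`), the window
form (`OldLayerDatumL1.total_le_of_geometric`) and the producer of `NE7LawLevelWindow.PureAverageL1Rate`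
(`pureAverageL1Rate_of_oldLayerBudgetL1`, with `oldLayerBudgetL1_of_oldLayerBudget`) are re-proved for it.
`OldLayerBudgetL1` is the shape the skeleton v1.7 cites for NODE Q.old.
-/

noncomputable section

open MeasureTheory Finset
open scoped BigOperators

namespace Summit.QuantumFields.BalabanUV.T4Continuum.NE7LawLevel

open Literature.MathematicalPhysics.QuantumFieldTheory.Balaban1983to89
open Literature.MathematicalPhysics.QuantumFieldTheory.Balaban1983to89.T4MeanChannel

/-! ## §1 The L¹-remainder datum, its total, and the pointwise datum as a special case -/

section DatumL1

variable {Ω : Type*} [MeasurableSpace Ω]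

/-- **NODE Q.old's PRODUCER with an L¹ TAYLOR REMAINDER (hypothesis SHAPE; v1.1).**  As `OldLayerDatum`, except that
the remainder `F − Φp − Σ_{n∈ages} S n` is only asked to be small in `L¹(P)`. [folklore] -/
structure OldLayerDatumL1 (P : Measure Ω) (F Φp : Ω → ℝ) where
  /-- the old ages present at this level -/
  ages : Finset ℕ
  /-- first-order summand of age `n` -/
  S : ℕ → Ω → ℝ
  /-- reverse filtration for age `n` -/
  𝓕 : ℕ → ℕ → MeasurableSpace Ω
  /-- number of layers used for age `n` -/
  depth : ℕ → ℕ
  /-- a pointwise bound of `S n` -/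
  bound : ℕ → ℝ
  /-- L¹ Taylor remainder budget -/
  rem : ℝ
  /-- resampling-noise variance budget of age `n` -/
  vNoise : ℕ → ℝ
  /-- layer-`j` conditional-variance budget of age `n` -/
  vLayer : ℕ → ℕ → ℝ
  /-- squared conditional-mean budget of age `n` at depth `depth n` -/
  mMean : ℕ → ℝ
  S_meas : ∀ n, Measurable (S n)
  S_bdd : ∀ n ω, |S n ω| ≤ bound n
  𝓕_le : ∀ n j, 𝓕 n j ≤ ‹MeasurableSpace Ω›
  𝓕_anti : ∀ n, Antitone (𝓕 n)
  taylorL1 : ∫ ω, |F ω - Φp ω - ∑ n ∈ ages, S n ω| ∂P ≤ rem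
  noise : ∀ n ∈ ages, ∫ ω, (S n ω - P[S n|𝓕 n 0] ω) ^ 2 ∂P ≤ vNoise n
  layer : ∀ n ∈ ages, ∀ j < depth n, ∫ ω, incr P (𝓕 n) (S n) j ω ^ 2 ∂P ≤ vLayer n j
  mean : ∀ n ∈ ages, ∫ ω, (P[S n|𝓕 n (depth n)]) ω ^ 2 ∂P ≤ mMean n

variable {P : Measure Ω} {F Φp : Ω → ℝ}

/-- The age-`n` bracket of an L¹ datum. -/
def OldLayerDatumL1.bracket (D : OldLayerDatumL1 P F Φp) (n : ℕ) : ℝ :=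
  D.vNoise n + ∑ j ∈ range (D.depth n), D.vLayer n j + D.mMean n

/-- The TOTAL of an L¹ datum: `rem + Σ_{n∈ages} √(bracket n)`. -/
def OldLayerDatumL1.total (D : OldLayerDatumL1 P F Φp) : ℝ :=
  D.rem + ∑ n ∈ D.ages, Real.sqrt (D.bracket n)

/-- A pointwise datum is an L¹ datum with the same budgets (probability space; `F`, `Φp`, `S n` measurable so that the
remainder is integrable). [folklore] -/
def OldLayerDatum.toL1 [IsProbabilityMeasure P] (hFm : Measurable F) (hΦm : Measurable Φp)
    (D : OldLayerDatum P F Φp) : OldLayerDatumL1 P F Φp where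
  ages := D.ages
  S := D.S
  𝓕 := D.𝓕
  depth := D.depth
  bound := D.bound
  rem := D.rem
  vNoise := D.vNoise
  vLayer := D.vLayer
  mMean := D.mMean
  S_meas := D.S_meas
  S_bdd := D.S_bdd
  𝓕_le := D.𝓕_le
  𝓕_anti := D.𝓕_anti
  taylorL1 := by
    have hm : Measurable fun ω => F ω - Φp ω - ∑ n ∈ D.ages, D.S n ω :=
      (hFm.sub hΦm).sub (Finset.measurable_sum _ fun n _ => D.S_meas n)
    have hi : Integrable (fun ω => |F ω - Φp ω - ∑ n ∈ D.ages, D.S n ω|) P :=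
      (T4VarianceMatching.integrable_of_abs_le P hm D.taylor).abs
    calc ∫ ω, |F ω - Φp ω - ∑ n ∈ D.ages, D.S n ω| ∂P ≤ ∫ _, D.rem ∂P :=
        integral_mono hi (integrable_const _) D.taylor
      _ = D.rem := by rw [integral_const, smul_eq_mul, probReal_univ, one_mul]
  noise := D.noise
  layer := D.layer
  mean := D.mean

/-- Each first-order summand of an L¹ datum is small in L¹: `∫|S n| ≤ √(bracket n)`. [folklore] -/
theorem OldLayerDatumL1.integral_abs_S_le [IsProbabilityMeasure P] (D : OldLayerDatumL1 P F Φp) {n : ℕ}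
    (hn : n ∈ D.ages) : ∫ ω, |D.S n ω| ∂P ≤ Real.sqrt (D.bracket n) :=
  integral_abs_le_sqrt_of_layerBudget (D.𝓕_anti n) (D.𝓕_le n) (D.S_meas n).aestronglyMeasurable (D.S_bdd n)
    (D.depth n) (D.noise n hn) (D.layer n hn) (D.mean n hn)

/-- **NODE Q.old ASSEMBLED, L¹-remainder form:** `∫ |F − Φp| dP ≤ total`. [folklore] -/
theorem integral_abs_sub_le_totalL1 [IsProbabilityMeasure P] (hFm : Measurable F) (hΦm : Measurable Φp)
    (hFb : ∀ ω, |F ω| ≤ 1) (hΦb : ∀ ω, |Φp ω| ≤ 1) (D : OldLayerDatumL1 P F Φp) :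
    ∫ ω, |F ω - Φp ω| ∂P ≤ D.total := by
  have hSi : ∀ n ∈ D.ages, Integrable (D.S n) P := fun n _ =>
    T4VarianceMatching.integrable_of_abs_le P (D.S_meas n) (D.S_bdd n)
  have hsum : Integrable (fun ω => ∑ n ∈ D.ages, D.S n ω) P := integrable_finsetSum _ hSi
  have hFΦ : Integrable (fun ω => F ω - Φp ω) P :=
    T4VarianceMatching.integrable_of_abs_le P (hFm.sub hΦm) (B := 2) fun ω =>
      (abs_sub _ _).trans (by linarith [hFb ω, hΦb ω])
  have hpt : ∀ ω, |F ω - Φp ω| ≤ |F ω - Φp ω - ∑ n ∈ D.ages, D.S n ω| + ∑ n ∈ D.ages, |D.S n ω| := fun ω => by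
    have h := abs_add_le (F ω - Φp ω - ∑ n ∈ D.ages, D.S n ω) (∑ n ∈ D.ages, D.S n ω)
    rw [sub_add_cancel] at h
    exact h.trans (add_le_add le_rfl (abs_sum_le_sum_abs _ _))
  have hR : Integrable (fun ω => |F ω - Φp ω - ∑ n ∈ D.ages, D.S n ω|) P := (hFΦ.sub hsum).abs
  have hA : Integrable (fun ω => ∑ n ∈ D.ages, |D.S n ω|) P := integrable_finsetSum _ fun n hn => (hSi n hn).abs
  calc ∫ ω, |F ω - Φp ω| ∂P ≤ ∫ ω, |F ω - Φp ω - ∑ n ∈ D.ages, D.S n ω| + ∑ n ∈ D.ages, |D.S n ω| ∂P :=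
        integral_mono hFΦ.abs (hR.add hA) hpt
    _ = ∫ ω, |F ω - Φp ω - ∑ n ∈ D.ages, D.S n ω| ∂P + ∑ n ∈ D.ages, ∫ ω, |D.S n ω| ∂P := by
        rw [integral_add hR hA, integral_finsetSum _ fun n hn => (hSi n hn).abs]
    _ ≤ D.rem + ∑ n ∈ D.ages, Real.sqrt (D.bracket n) :=
        add_le_add D.taylorL1 (sum_le_sum fun n hn => D.integral_abs_S_le hn)

/-- The window form for an L¹ datum: geometric age profile ⇒ `total ≤ rem + c·q^{n₀}/(1 − q)`. [folklore] -/
theorem OldLayerDatumL1.total_le_of_geometric (D : OldLayerDatumL1 P F Φp) {n₀ : ℕ} {c q : ℝ} (hc : 0 ≤ c)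
    (hq0 : 0 ≤ q) (hq1 : q < 1) (hages : ∀ n ∈ D.ages, n₀ ≤ n)
    (hbr : ∀ n ∈ D.ages, D.bracket n ≤ (c * q ^ n) ^ 2) : D.total ≤ D.rem + c * q ^ n₀ / (1 - q) := by
  unfold OldLayerDatumL1.total
  refine add_le_add le_rfl ?_
  have h1 : ∑ n ∈ D.ages, Real.sqrt (D.bracket n) ≤ ∑ n ∈ D.ages, c * q ^ n :=
    sum_le_sum fun n hn => by
      calc Real.sqrt (D.bracket n) ≤ Real.sqrt ((c * q ^ n) ^ 2) := Real.sqrt_le_sqrt (hbr n hn)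
        _ = c * q ^ n := Real.sqrt_sq (mul_nonneg hc (pow_nonneg hq0 n))
  refine h1.trans ?_
  obtain ⟨m, hm⟩ : ∃ m, ∀ n ∈ D.ages, n < n₀ + m := by
    refine ⟨D.ages.sup id + 1, fun n hn => ?_⟩
    have : n ≤ D.ages.sup id := le_sup (f := id) hn
    omega
  have hsub : D.ages ⊆ Ico n₀ (n₀ + m) := fun n hn => mem_Ico.mpr ⟨hages n hn, hm n hn⟩
  calc ∑ n ∈ D.ages, c * q ^ n ≤ ∑ n ∈ Ico n₀ (n₀ + m), c * q ^ n :=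
        sum_le_sum_of_subset_of_nonneg hsub fun n _ _ => mul_nonneg hc (pow_nonneg hq0 n)
    _ = c * ∑ n ∈ Ico n₀ (n₀ + m), q ^ n := by rw [mul_sum]
    _ ≤ c * (q ^ n₀ / (1 - q)) := mul_le_mul_of_nonneg_left (geom_sum_Ico_le_of_lt_one hq0 hq1) hc
    _ = c * q ^ n₀ / (1 - q) := mul_div_assoc' c _ _

end DatumL1

/-! ## §2 The per-`K` budget shape (L¹ form) and the producer of `PureAverageL1Rate` -/

section ProducerL1

variable {O : Type*}

/-- **OLD-LAYER BUDGET, L¹-remainder form (ONE-RUN hypothesis shape, NOT PRINTED; the shape the skeleton cites).**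
[folklore] -/
def OldLayerBudgetL1 (Ω : ℕ → Type*) [∀ K, MeasurableSpace (Ω K)] (P : ∀ K, Measure (Ω K))
    (F Φp : ∀ K, List O → Ω K → ℝ) (s : ℕ → ℝ) : Prop :=
  ∀ os, ∃ C : ℝ, 0 ≤ C ∧ ∀ K, Measurable (F K os) ∧ Measurable (Φp K os) ∧ (∀ ω, |F K os ω| ≤ 1) ∧
    (∀ ω, |Φp K os ω| ≤ 1) ∧ 0 ≤ s K ∧ ∃ D : OldLayerDatumL1 (P K) (F K os) (Φp K os), D.total ≤ C * s K

/-- The pointwise budget implies the L¹ budget. [folklore] -/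
theorem oldLayerBudgetL1_of_oldLayerBudget {Ω : ℕ → Type*} [∀ K, MeasurableSpace (Ω K)] {P : ∀ K, Measure (Ω K)}
    [∀ K, IsProbabilityMeasure (P K)] {F Φp : ∀ K, List O → Ω K → ℝ} {s : ℕ → ℝ}
    (h : OldLayerBudget Ω P F Φp s) : OldLayerBudgetL1 Ω P F Φp s := by
  intro os
  obtain ⟨C, hC0, hC⟩ := h os
  refine ⟨C, hC0, fun K => ?_⟩
  obtain ⟨hFm, hΦm, hFb, hΦb, hs0, D, hD⟩ := hC K
  exact ⟨hFm, hΦm, hFb, hΦb, hs0, D.toL1 hFm hΦm, hD⟩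

/-- **NODE Q.old PRODUCED (L¹-remainder form): the old-layer budget gives `PureAverageL1Rate`.** [folklore] -/
theorem pureAverageL1Rate_of_oldLayerBudgetL1 {Ω : ℕ → Type*} [∀ K, MeasurableSpace (Ω K)] {P : ∀ K, Measure (Ω K)}
    [∀ K, IsProbabilityMeasure (P K)] {F Φp : ∀ K, List O → Ω K → ℝ} {s : ℕ → ℝ}
    (h : OldLayerBudgetL1 Ω P F Φp s) : PureAverageL1Rate Ω P F Φp s := by
  intro os
  obtain ⟨C, hC0, hC⟩ := h os
  refine ⟨C, hC0, fun K => ?_⟩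
  obtain ⟨hFm, hΦm, hFb, hΦb, hs0, D, hD⟩ := hC K
  exact ⟨hFm, hΦm, hFb, hΦb, hs0, (integral_abs_sub_le_totalL1 hFm hΦm hFb hΦb D).trans hD⟩

end ProducerL1

end Summit.QuantumFields.BalabanUV.T4Continuum.NE7LawLevel

end
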